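import Literature.MathematicalPhysics.QuantumFieldTheory.Balaban1983to89.BlockAveragingEMLLinearisedBackground
import Literature.MathematicalPhysics.QuantumFieldTheory.Balaban1983to89.B12B0LoopStructure267
import HarnessLib

/-!
# S2β (line g18-1, organ GAP♯∘, letter AVG₂♭-ax_q, sup chain (ST)∕LIFT-LADDER) — (O3) THE COARSE CHORD READ LINEARLY FROM THE TWO BLOCKS:
# the LOCAL-SUP edition of [Balaban1985Averaging] Prop. 3 (121)–(124) for (0.4), and the central line read at `b₀(c)` only

Cell `ym3-torus`, seat `ym3-torus-px17` g22 (architect of the S2β AVG₂♭ sup chain, files ✓p829296 ∕ ✓p829725 ∕ ✓p830137 ∕ ✓p830683), for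
crux `stmt-QuantumFields-20520` `FluctuationComparisonRegPrIntL`, line g18-1 `semiclassical_s2beta` (registry sha16 3732b7df, UNTOUCHED),
organ `stub_uniformFibreGapOrbit` (GAP♯∘).  Count-neutral helper (`--supports stmt-QuantumFields-20520`); 0 `def`, 0 `sorry`.

WHAT THIS FILE IS FOR.  The lift ladder of the sup chain ((TOP-LAD)∕(LIFT-LAD′) of ✓`…S2BetaSupTowerOfLiftLadder.supTowerLetter_of_liftLadderLetter`)
compares, level by level, the chords `U′^{(u)}_c·(U₁′^{(u)}_c)⁻¹` of the two stage towers of a pair; one level up they are ONE (0.4) averaging of the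
level-`(u+1)` fields (✓`…QuaternionReadOneStepDictionary.descendTo_succ_apply`).  The tree already PROVES the first-order reading of one (0.4)
averaging of `U` against a small-field background `U₀` — `BlockAveragingEMLLinearisedBackground.norm_avgFun_ratio_sub_one_sub_covLinAvgR0_le`:
`‖Ū(c)Ū₀(c)* − 1 − (Q₁^{R₀}(U₀)Y)(c)‖ ≤ 404·ℓδ·(ℓδ + α)`, `Y_b = U_bU₀,b⁻¹ − 1`, `ℓ = (d+2)L`, where `(Q₁^{R₀}(U₀)Y)(c) = covLinAvgR0 U₀ Y c` is the MEAN over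
the index set `Idx = (Fin d → Fin L) × Perm × Perm` of (0.4) of [comb sum along `Γ^σ_{y→x}` + comb-transported RUN sum along `[x, x+Le_μ]` − loop-transported
comb sum along `Γ′^{σ′}`] (covariant signed sums (58) p. 27) — this IS the «non-abelian run∕face-mean reading of the coarse chord» the c₃ row of the
ladder asked for (bus (O3), 2026-08-31), to first order, with a remainder `(chord-sup)² + α·(chord-sup)`.  But the printed hypotheses there take the
GLOBAL sup `∀ b, ‖Y_b‖ ≤ δ`, while the sup tower prices the sup over the READ SET of the coarse bond — the bonds issuing from the two blocks
`B(c₋) ∪ B(c₊)`.  This file supplies the LOCAL-SUP editions, by splicing: the field `b ↦ U_b` on the two blocks, `U₀,b` elsewhere, has the same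
average at `c` (lit ✓`BlockAveraging.avgFun_local`) and the same linear term (every bond the linear term reads issues from the two blocks, lit
✓`blockOf_src_of_mem_walk`, ✓`B12B0LoopGeometry267.stair_src_tgt_blockOf`), and its global perturbation sup is the local one.

WHAT IS PROVED (kernel, 0 sorry):
* §1 `covWalkSum_congr`, `covWalkSum_eq_zero`, `mem_loop_of_mem_run`, `covLinAvgR0_congr_local` — the linear term reads only bonds issuing from `B(c₋) ∪ B(c₊)`.
* §2 `pertVar_splice` — the perturbation of the spliced field.
* §3 ★ `norm_avgFun_ratio_sub_one_sub_covLinAvgR0_le_local` — Prop. 3 (121)–(124) in `R₀` form with `hY : ∀ b, (blockOf b.src = c.src ∨ blockOf b.src = c.tgt) →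
  ‖pertVar U₀ U b‖ ≤ δ` (the READ-set guard of the sup chain, one level, verbatim), same conclusion `≤ 404·ℓδ(ℓδ+α)`;
  ★ `norm_covLinAvgR0_le_local` — (126) crude `‖Q₁^{R₀}(U₀)Y‖ ≤ 3ℓδ` from the local sup.
* §5 (exact, any gauge group, any `LoopAverage`) `axialAvg_mul_inv_eq_conj_b0` (`U(c)V(c)⁻¹ = R(U([emb c₋,b₀₋]))(U_{b₀}V_{b₀}⁻¹)` for a pair agreeing off `b₀(c)`
  on the central line, lit ✓`rowProd_axis_split`, ✓`B12B0LoopStructure267.axialAvg_eq_rowProd`), `dist1_b0_chord_eq`, `dist1_avgFun_chord_le_and` (the correction factors enter only through `dist1 (κ_U κ_V⁻¹)`).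
* §4 the central line read at `b₀(c)` only (top stage: the pair agrees on tree-comb bonds, ✓`…S2BetaTreeCombBondStep.stageChord_treeComb_top`, and the
  central line's bonds other than `b₀(c)` are tree-comb): `covWalkSum_line_eq_of_eq_zero_off_b0` —
  `Y_{U₀}([emb c₋, emb c₊]) = R(U₀([emb c₋, b₀₋]))·Y_{b₀(c)}` when `Y = 0` on the other central-line bonds (lit ✓`B12B0LoopGeometry267.b0_eq_shiftN_emb`).

HONEST FRAMING.  Bookkeeping adapters around ONE proved lit proposition; the ladder letters (TOP-LAD)∕(LIFT-LAD′)∕(SCT), (ST′), (ST), LOC, AVG₂♭-ax_q,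
GAP♯∘, S2-β, crux 20520 and `YM3TorusSU2` are NOT proved here.  INHABITATION (RULING №100): n∕a — no GAP♯-shaped binder; every hypothesis is a
pointwise bound or an equation on explicitly given fields.  Rung R3 = SU(2) YM₃ on T³ — NOT d = 4, NOT infinite volume, NOT a mass gap, NOT Clay.
-/

namespace Summit.QuantumFields.YangMills.Theorems.FluctuationComparisonRegPrIntLS2BetaCoarseChordLinearReadingLocal

open Literature.MathematicalPhysics.QuantumFieldTheory.Balaban1983to89
open T4Continuum BlockAveraging AveragingRT ExpMeanLog BlockAveragingEMLLinearised BlockAveragingEMLLinearisedBackground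
  B10Eq47AxialChi B12B0LoopGeometry267 B12B0LoopStructure267
open B12SmallFieldDomain259 (b0)
open scoped Matrix.Norms.L2Operator BigOperators

variable {n : Type*} [Fintype n] [DecidableEq n] [Nonempty n] {P : Params} {j : ℕ}

/-! ## §1 The linear term reads only bonds issuing from the two blocks -/

omit [Nonempty n] in
/-- The covariant signed sum along `γ` depends on `Y` only through the bonds of `γ`. [cite: Balaban1985Averaging, (58) p.27 (bookkeeping)] -/
theorem covWalkSum_congr (U₀ : GaugeField P j (Matrix.specialUnitaryGroup n ℂ)) {Y Y' : PBond P j → Matrix n n ℂ} :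
    ∀ {γ : List (LStep P j)}, (∀ s ∈ γ, Y s.bond = Y' s.bond) → covWalkSum U₀ Y γ = covWalkSum U₀ Y' γ
  | [], _ => by simp
  | s :: γ, h => by
    rw [covWalkSum_cons, covWalkSum_cons, covWalkSum_congr U₀ (γ := γ) fun s' hs' => h s' (List.mem_cons_of_mem _ hs')]
    have hs := h s (List.mem_cons_self ..)
    simp only [covStep, hs]

omit [Nonempty n] in
/-- A covariant signed sum of a field vanishing on the walk vanishes. [cite: Balaban1985Averaging, (58) p.27 (bookkeeping)] -/
theorem covWalkSum_eq_zero (U₀ : GaugeField P j (Matrix.specialUnitaryGroup n ℂ)) {Y : PBond P j → Matrix n n ℂ} :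
    ∀ {γ : List (LStep P j)}, (∀ s ∈ γ, Y s.bond = 0) → covWalkSum U₀ Y γ = 0
  | [], _ => by simp
  | s :: γ, h => by
    rw [covWalkSum_cons, covWalkSum_eq_zero U₀ (γ := γ) fun s' hs' => h s' (List.mem_cons_of_mem _ hs')]
    have hs := h s (List.mem_cons_self ..)
    simp [covStep, hs]

/-- The run `[x, x′]` of a (0.4) loop at `c` is a sub-walk of the loop walk. [cite: Balaban1987RG1, (0.4) p.253 (bookkeeping)] -/
theorem mem_loop_of_mem_run (c : PBond P (j + 1)) (i : Idx P) (s : LStep P j)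
    (hs : s ∈ walk (walkEnd (emb c.src) (stairWord i.2.1 (off i.1))) (List.replicate P.L (c.dir, true))) :
    s ∈ walk (emb c.src) (loopWord P.L c.dir (off i.1) i.2.1 i.2.2) := by
  unfold loopWord
  rw [walk_append, walk_append]
  exact List.mem_append_right _ (List.mem_append_left _ hs)

/-- **THE LINEAR TERM `Q₁^{R₀}(U₀)Y` AT `c` READS ONLY BONDS ISSUING FROM `B(c₋) ∪ B(c₊)`** (staircases stay in their blocks; the run is on the loop).
[cite: Balaban1985Averaging, (124)-(125) p.36; Balaban1987RG1, (0.3)-(0.4) pp.252-253] -/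
theorem covLinAvgR0_congr_local (hj : j + 1 ≤ P.m + P.K) (U₀ : GaugeField P j (Matrix.specialUnitaryGroup n ℂ))
    {Y Y' : PBond P j → Matrix n n ℂ} (c : PBond P (j + 1))
    (h : ∀ b : PBond P j, (blockOf b.src = c.src ∨ blockOf b.src = c.tgt) → Y b = Y' b) :
    covLinAvgR0 U₀ Y c = covLinAvgR0 U₀ Y' c := by
  unfold covLinAvgR0
  congr 1
  refine Finset.sum_congr rfl fun i _ => ?_
  have hΓ : ∀ s ∈ walk (emb c.src) (stairWord i.2.1 (off i.1)), Y s.bond = Y' s.bond :=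
    fun s hs => h _ (Or.inl (stair_src_tgt_blockOf hj c.src i.2.1 i.1 s hs).1)
  have hΓ' : ∀ s ∈ walk (emb c.tgt) (stairWord i.2.2 (off i.1)), Y s.bond = Y' s.bond :=
    fun s hs => h _ (Or.inr (stair_src_tgt_blockOf hj c.tgt i.2.2 i.1 s hs).1)
  have hR : ∀ s ∈ walk (walkEnd (emb c.src) (stairWord i.2.1 (off i.1))) (List.replicate P.L (c.dir, true)),
      Y s.bond = Y' s.bond :=
    fun s hs => h _ (blockOf_src_of_mem_walk hj c i s (mem_loop_of_mem_run c i s hs))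
  rw [covWalkSum_congr U₀ hΓ, covWalkSum_congr U₀ hΓ', covWalkSum_congr U₀ hR]

/-! ## §2 The spliced field -/

omit [Nonempty n] in
/-- The perturbation of the spliced field `b ↦ U_b` (on `p`), `U₀,b` (off `p`) is `Y_b` on `p` and `0` off `p`. [cite: Balaban1985Variational, (15) p.280 (bookkeeping)] -/
theorem pertVar_splice (U₀ U : GaugeField P j (Matrix.specialUnitaryGroup n ℂ)) (p : PBond P j → Prop) [DecidablePred p] (b : PBond P j) :
    pertVar U₀ (fun b' => if p b' then U b' else U₀ b') b = if p b then pertVar U₀ U b else 0 := by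
  by_cases hb : p b <;> simp [pertVar, hb]

/-! ## §3 The local-sup editions -/

/-- ★ **[Balaban1985Averaging] PROP. 3 (121)–(124) FOR (0.4), `R₀` FORM, WITH THE SUP OF THE PERTURBATION TAKEN OVER THE TWO BLOCKS ONLY**:
the hypothesis `‖Y_b‖ ≤ δ` is asked only of bonds `b` with `b₋ ∈ B(c₋) ∪ B(c₊)` (the one-level read set of the sup chain); same conclusion
`‖Ū(c)Ū₀(c)* − 1 − (Q₁^{R₀}(U₀)Y)(c)‖ ≤ 404·ℓδ·(ℓδ + α)`.  Proof: the lit theorem for the spliced field, lit `avgFun_local`, §1.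
[cite: Balaban1985Averaging, Proposition 3 (121)-(124) p.36] -/
theorem norm_avgFun_ratio_sub_one_sub_covLinAvgR0_le_local (hj : j + 1 ≤ P.m + P.K)
    (U₀ U : GaugeField P j (Matrix.specialUnitaryGroup n ℂ)) {δ α : ℝ} (hδ : 0 ≤ δ) (c : PBond P (j + 1))
    (hY : ∀ b : PBond P j, (blockOf b.src = c.src ∨ blockOf b.src = c.tgt) → ‖pertVar U₀ U b‖ ≤ δ)
    (h48 : 48 * ((((P.d + 2) * P.L : ℕ) : ℝ) * δ) ≤ 1)
    (hα : ∀ i, dist1 (loopHol U₀ c i) ≤ α) (hα24 : α ≤ 1 / 24) (hN : 2 * ((((P.d + 2) * P.L : ℕ) : ℝ) * δ) + α < deltaSU n) :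
    ‖((avgFun (expMeanLogSU (n := n)) U c : Matrix.specialUnitaryGroup n ℂ) : Matrix n n ℂ) *
          star ((avgFun (expMeanLogSU (n := n)) U₀ c : Matrix.specialUnitaryGroup n ℂ) : Matrix n n ℂ) - 1 -
        covLinAvgR0 U₀ (pertVar U₀ U) c‖ ≤
      404 * ((((P.d + 2) * P.L : ℕ) : ℝ) * δ) * ((((P.d + 2) * P.L : ℕ) : ℝ) * δ + α) := by
  classical
  have hYV : ∀ b, ‖pertVar U₀ (fun b' => if (blockOf b'.src = c.src ∨ blockOf b'.src = c.tgt) then U b' else U₀ b') b‖ ≤ δ := by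
    intro b
    rw [pertVar_splice]
    split_ifs with hb
    · exact hY b hb
    · simpa using hδ
  have hmain := norm_avgFun_ratio_sub_one_sub_covLinAvgR0_le U₀ _ hδ hYV h48 c hα hα24 hN
  have hav : avgFun (expMeanLogSU (n := n))
      (fun b' => if (blockOf b'.src = c.src ∨ blockOf b'.src = c.tgt) then U b' else U₀ b') c = avgFun (expMeanLogSU (n := n)) U c :=
    avgFun_local _ hj _ U c fun b hb => if_pos hb
  have hcov : covLinAvgR0 U₀ (pertVar U₀ fun b' => if (blockOf b'.src = c.src ∨ blockOf b'.src = c.tgt) then U b' else U₀ b') c =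
      covLinAvgR0 U₀ (pertVar U₀ U) c :=
    covLinAvgR0_congr_local hj U₀ c fun b hb => by rw [pertVar_splice]; exact if_pos hb
  rw [hav, hcov] at hmain
  exact hmain

omit [Nonempty n] in
/-- ★ **(126) CRUDE, LOCAL SUP**: `‖(Q₁^{R₀}(U₀)Y)(c)‖ ≤ 3ℓ·δ` when `‖Y_b‖ ≤ δ` on the bonds issuing from `B(c₋) ∪ B(c₊)`.
[cite: Balaban1985Averaging, (126) p.36] -/
theorem norm_covLinAvgR0_le_local [Nonempty n] (hj : j + 1 ≤ P.m + P.K) (U₀ : GaugeField P j (Matrix.specialUnitaryGroup n ℂ))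
    {Y : PBond P j → Matrix n n ℂ} {δ : ℝ} (hδ : 0 ≤ δ) (c : PBond P (j + 1))
    (hY : ∀ b : PBond P j, (blockOf b.src = c.src ∨ blockOf b.src = c.tgt) → ‖Y b‖ ≤ δ) :
    ‖covLinAvgR0 U₀ Y c‖ ≤ 3 * ((((P.d + 2) * P.L : ℕ) : ℝ) * δ) := by
  classical
  have hYV : ∀ b, ‖(fun b' => if (blockOf b'.src = c.src ∨ blockOf b'.src = c.tgt) then Y b' else 0) b‖ ≤ δ := by
    intro b
    simp only
    split_ifs with hb
    · exact hY b hb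
    · simpa using hδ
  have h := norm_covLinAvgR0_le U₀ hYV c
  have hc : covLinAvgR0 U₀ (fun b' => if (blockOf b'.src = c.src ∨ blockOf b'.src = c.tgt) then Y b' else 0) c = covLinAvgR0 U₀ Y c :=
    covLinAvgR0_congr_local hj U₀ c fun b hb => if_pos hb
  rwa [hc] at h

/-! ## §4 The central line read at `b₀(c)` only -/

/-- The central line of `c` split at `b₀(c)`: `[emb c₋, emb c₊] = [emb c₋, b₀₋] · b₀(c) · [b₀₊, emb c₊]` as words (`L = 2h+1`, `h = (L−1)/2`).
[cite: Balaban1987RG1, p.267 (bookkeeping)] -/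
theorem walk_line_eq_append (c : PBond P (j + 1)) :
    walk (emb c.src) (List.replicate P.L (c.dir, true)) =
      walk (emb c.src) (List.replicate ((P.L - 1) / 2) (c.dir, true)) ++
        (⟨⟨shiftN (emb c.src) c.dir ((P.L - 1) / 2), c.dir⟩, true⟩ ::
          walk (shiftN (emb c.src) c.dir ((P.L - 1) / 2 + 1)) (List.replicate ((P.L - 1) / 2) (c.dir, true))) := by
  have hL := two_mul_half_add_one P
  conv_lhs => rw [show P.L = (P.L - 1) / 2 + (1 + (P.L - 1) / 2) by omega, List.replicate_add, List.replicate_add]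
  rw [walk_append, BlockAveragingEMLProp2.walkEnd_replicate_true]
  rfl

/-- ★ **THE CENTRAL LINE READ AT `b₀(c)` ONLY**: if `Y` vanishes on the central-line bonds `⟨emb c₋ + te_μ, μ⟩`, `t < L`, `t ≠ (L−1)/2` (top stage:
they are tree-comb bonds of `B(c₋)` resp. `B(c₊)`, on which the pair agrees), then
`Y_{U₀}([emb c₋, emb c₊]) = U₀([emb c₋, b₀₋]) · Y_{b₀(c)} · U₀([emb c₋, b₀₋])*`. [cite: Balaban1985Averaging, (58) p.27, (124) p.36; Balaban1987RG1, p.267] -/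
theorem covWalkSum_line_eq_of_eq_zero_off_b0 (U₀ : GaugeField P j (Matrix.specialUnitaryGroup n ℂ)) (Y : PBond P j → Matrix n n ℂ)
    (c : PBond P (j + 1)) (hY : ∀ t < P.L, t ≠ (P.L - 1) / 2 → Y ⟨shiftN (emb c.src) c.dir t, c.dir⟩ = 0) :
    covWalkSum U₀ Y (walk (emb c.src) (List.replicate P.L (c.dir, true))) =
      ((holAt U₀ (walk (emb c.src) (List.replicate ((P.L - 1) / 2) (c.dir, true))) : Matrix.specialUnitaryGroup n ℂ) : Matrix n n ℂ) *
        Y (b0 c) * star ((holAt U₀ (walk (emb c.src) (List.replicate ((P.L - 1) / 2) (c.dir, true))) : Matrix.specialUnitaryGroup n ℂ) : Matrix n n ℂ) := by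
  have hL := two_mul_half_add_one P
  have h1 : ∀ s ∈ walk (emb c.src) (List.replicate ((P.L - 1) / 2) (c.dir, true)), Y s.bond = 0 := by
    intro s hs
    obtain ⟨t, ht, rfl⟩ := (mem_walk_replicate_true _ _ _ s).1 hs
    exact hY t (by omega) (by omega)
  have h2 : ∀ s ∈ walk (shiftN (emb c.src) c.dir ((P.L - 1) / 2 + 1)) (List.replicate ((P.L - 1) / 2) (c.dir, true)), Y s.bond = 0 := by
    intro s hs
    obtain ⟨t, ht, rfl⟩ := (mem_walk_replicate_true _ _ _ s).1 hs
    have hsh : ∀ (x : Site P j) (a b : ℕ), shiftN x c.dir (a + b) = shiftN (shiftN x c.dir a) c.dir b := by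
      intro x a b
      induction b with
      | zero => rfl
      | succ b ih => rw [← Nat.add_assoc, shiftN_succ, ih, shiftN_succ]
    simp only
    rw [← hsh]
    exact hY _ (by omega) (by omega)
  rw [walk_line_eq_append, covWalkSum_append, covWalkSum_eq_zero U₀ h1, zero_add, covWalkSum_cons, covWalkSum_eq_zero U₀ h2,
    b0_eq_shiftN_emb]
  simp [covStep]

/-! ## §5 The exact form: the straight-line chord of a pair agreeing off `b₀(c)` is the conjugated `b₀(c)` chord -/

section Exact

variable {G : Type*} [GaugeGroup G]

/-- ★ **EXACT**: if two configurations agree on the central-line bonds of `c` other than `b₀(c)`, then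
`U(c)·V(c)⁻¹ = U([emb c₋, b₀₋]) · (U_{b₀(c)} V_{b₀(c)}⁻¹) · U([emb c₋, b₀₋])⁻¹` (any gauge group, no averaging axiom used).
[cite: Balaban1987RG1, p.267; Balaban1985Averaging, (9) p.19] -/
theorem axialAvg_mul_inv_eq_conj_b0 (hj : j + 1 ≤ P.m + P.K) (U V : GaugeField P j G) (c : PBond P (j + 1))
    (hUV : ∀ t < P.L, t ≠ (P.L - 1) / 2 → U ⟨shiftN (emb c.src) c.dir t, c.dir⟩ = V ⟨shiftN (emb c.src) c.dir t, c.dir⟩) :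
    axialAvg U c * (axialAvg V c)⁻¹ =
      rowProd U (emb c.src) c.dir ((P.L - 1) / 2) * (U (b0 c) * (V (b0 c))⁻¹) * (rowProd U (emb c.src) c.dir ((P.L - 1) / 2))⁻¹ := by
  classical
  have hL := two_mul_half_add_one P
  have h1 : rowProd V (emb c.src) c.dir ((P.L - 1) / 2) = rowProd U (emb c.src) c.dir ((P.L - 1) / 2) :=
    rowProd_congr _ _ _ fun t ht => (hUV t (by omega) (by omega)).symm
  have h2 : rowProd V (shiftN (emb c.src) c.dir ((P.L - 1) / 2 + 1)) c.dir ((P.L - 1) / 2) =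
      rowProd U (shiftN (emb c.src) c.dir ((P.L - 1) / 2 + 1)) c.dir ((P.L - 1) / 2) :=
    rowProd_congr _ _ _ fun t ht => by
      have hsh : ∀ (x : Site P j) (a b : ℕ), shiftN x c.dir (a + b) = shiftN (shiftN x c.dir a) c.dir b := by
        intro x a b
        induction b with
        | zero => rfl
        | succ b ih => rw [← Nat.add_assoc, shiftN_succ, ih, shiftN_succ]
      rw [← hsh]
      exact (hUV _ (by omega) (by omega)).symm
  rw [axialAvg_eq_rowProd, axialAvg_eq_rowProd, (rowProd_axis_split hj U c 1).1, (rowProd_axis_split hj V c 1).1, h1, h2]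
  group

/-- Hence, in the invariant distance: `dist1 (U_{b₀}V_{b₀}⁻¹) = dist1 (U(c)V(c)⁻¹)` for such a pair (conjugation invariance (19)–(20)).
[cite: Balaban1985Averaging, (19)-(20) p.21] -/
theorem dist1_b0_chord_eq (hj : j + 1 ≤ P.m + P.K) (U V : GaugeField P j G) (c : PBond P (j + 1))
    (hUV : ∀ t < P.L, t ≠ (P.L - 1) / 2 → U ⟨shiftN (emb c.src) c.dir t, c.dir⟩ = V ⟨shiftN (emb c.src) c.dir t, c.dir⟩) :
    dist1 (U (b0 c) * (V (b0 c))⁻¹) = dist1 (axialAvg U c * (axialAvg V c)⁻¹) := by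
  rw [axialAvg_mul_inv_eq_conj_b0 hj U V c hUV, GaugeGroup.dist1_conj]

/-- And for the full (0.4) average `Ū = κ·U(c)` (`κ` the correction factor): `dist1 (Ū(c)V̄(c)⁻¹) ≤ dist1 (U_{b₀}V_{b₀}⁻¹) + dist1 (κ_U κ_V⁻¹)` and
`dist1 (U_{b₀}V_{b₀}⁻¹) ≤ dist1 (Ū(c)V̄(c)⁻¹) + dist1 (κ_U κ_V⁻¹)` for such a pair. [cite: Balaban1987RG1, (0.4) p.253; Balaban1985Averaging, (19)-(20) p.21] -/
theorem dist1_avgFun_chord_le_and (ℰ : LoopAverage G) (hj : j + 1 ≤ P.m + P.K) (U V : GaugeField P j G) (c : PBond P (j + 1))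
    (hUV : ∀ t < P.L, t ≠ (P.L - 1) / 2 → U ⟨shiftN (emb c.src) c.dir t, c.dir⟩ = V ⟨shiftN (emb c.src) c.dir t, c.dir⟩) :
    dist1 (avgFun ℰ U c * (avgFun ℰ V c)⁻¹) ≤ dist1 (U (b0 c) * (V (b0 c))⁻¹) + dist1 (corr ℰ U c * (corr ℰ V c)⁻¹) ∧
      dist1 (U (b0 c) * (V (b0 c))⁻¹) ≤ dist1 (avgFun ℰ U c * (avgFun ℰ V c)⁻¹) + dist1 (corr ℰ U c * (corr ℰ V c)⁻¹) := by
  have e : ∀ W : GaugeField P j G, avgFun ℰ W c = corr ℰ W c * axialAvg W c := fun W => rfl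
  have hb := dist1_b0_chord_eq hj U V c hUV
  have key : avgFun ℰ U c * (avgFun ℰ V c)⁻¹ =
      (corr ℰ U c * (axialAvg U c * (axialAvg V c)⁻¹) * (corr ℰ U c)⁻¹) * (corr ℰ U c * (corr ℰ V c)⁻¹) := by
    rw [e, e]; group
  constructor
  · rw [key, hb]
    exact (GaugeGroup.dist1_mul_le _ _).trans (by rw [GaugeGroup.dist1_conj])
  · rw [hb]
    have e2 : axialAvg U c * (axialAvg V c)⁻¹ =
        ((corr ℰ U c)⁻¹ * (avgFun ℰ U c * (avgFun ℰ V c)⁻¹) * ((corr ℰ U c)⁻¹)⁻¹) *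
          ((corr ℰ U c)⁻¹ * (corr ℰ U c * (corr ℰ V c)⁻¹) * ((corr ℰ U c)⁻¹)⁻¹)⁻¹ := by
      rw [e, e]; group
    rw [e2]
    refine (GaugeGroup.dist1_mul_le _ _).trans ?_
    rw [GaugeGroup.dist1_conj, GaugeGroup.dist1_inv, GaugeGroup.dist1_conj]

end Exact

end Summit.QuantumFields.YangMills.Theorems.FluctuationComparisonRegPrIntLS2BetaCoarseChordLinearReadingLocal
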